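import Literature.Geometry.Symplectic.OrigamiCutRealSlice
import Literature.Geometry.Symplectic.OrigamiCutSpaceForm
import HarnessLib

/-!
# Gluing a side of the fold to the cut space along the collar: the gluing maps

Proofs companion of `OrigamiUnfolding.lean` (the named fact
`Literature.Geometry.Symplectic.exists_symplecticCutPieces_of_isOrigamiForm`, Cannas da
Silva–Guillemin–Pires, *Symplectic Origami*, IMRN 2011 = arXiv:0909.4065, Prop. 2.8), step (S3):
"`M₀⁺` is obtained by gluing `M⁺` and the cut `μ⁻¹(0)/S¹` along the symplectomorphism
`j⁺ : 𝒰⁺ → μ⁻¹(0)/S¹`, `φ(x, s) ↦ [x, s, √(2s)]`" (proof of Prop. 2.8), in the tree's rendering: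
an open side `V` of a compact 4-manifold, a normal-form collar `c : N × (-δ, δ) → M` of its
frontier (`c (N × (0, δ)) ⊆ V`, the rest outside `V`) and the cut space `CutSpace 3 N`
(`OrigamiCutSpace.lean`) are glued along `c (n, t) ↦ [n, t]`, `0 < t < δ`.

This file fixes the abstract SETTING as a structure `CutCollarData M N` (the form `s`, the side
`V`, the collar `c`, the basic form `ωZ` and connection form `α` on `N`, with the hypotheses
produced by the normal-form fact `exists_origamiCollarNormalForm` and by the origami structure)
and constructs the two gluing maps:

* `CutCollarData.cInv` — the inverse collar (`invFunOn c band`), `C^∞` on the open band image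
  (`InjOnLocalDiffeomorphInverse.lean`), with `cInv_c`, `c_cInv`;
* `CutCollarData.glueFun : V → cutDisc δ` — `a = c(n, t) ↦ [n, t]` on the half-band image
  (junk `[n, δ/2]` elsewhere), `CutCollarData.unglueFun : cutDisc δ → V` — `[n, w] ↦
  c (cutUnslice [n, w])` off the zero section (junk `c (n₀, δ/2)` on it); the identities
  `unglueFun_glueFun`, `glueFun_unglueFun` on the source `glueSource = {a | ↑a ∈ c (N × (0, δ))}`
  and target `glueTarget = {b | |w|² ≠ 0}`, their openness, and `C^∞` smoothness of both maps
  there (`contMDiffOn_glueFun`, `contMDiffOn_unglueFun`).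

The `OpenPartialHomeomorph`, the `SmoothGlueData` and the topology of the glued piece are
assembled in the sequel `OrigamiCutGlue.lean`.  Everything here is proved; no facts.

## References

* A. Cannas da Silva, V. Guillemin, A. R. Pires, *Symplectic Origami*, IMRN 2011 =
  arXiv:0909.4065, proofs of Prop. 2.8 and Prop. 2.26. [CannasdasilvaGuilleminPires2010]
-/

noncomputable section

open scoped Manifold ContDiff Topology
open Set Function Filter TopologicalSpace
open Literature.Geometry.Kaehler Literature.Geometry.Manifold

namespace Literature.Geometry.Symplectic

universe u

/-- **Setting for gluing a side of a fold to the cut space** (Cannas da Silva–Guillemin–Pires,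
proof of Prop. 2.8, one side): a smooth closed `2`-form `s` on a `4`-manifold `M`, an open side
`V`, a compact `3`-manifold `N` with a free smooth circle action, a basic closed `2`-form `ωZ` on
`N` whose kernel is the orbit line and a connection `1`-form `α`, and a collar `c : N × ℝ → M`,
`C^∞`, injective with bijective differential on the band `N × (-δ, δ)`, taking `N × (0, δ)` into
`V` and `N × (-δ, 0]` outside, with `closure V ⊆ V ∪ c (N × {0})`, along which `s` is in NORMAL
FORM `c^*s = pr₁^*ωZ + d(t² pr₁^*α)`, and `s` non-degenerate on `V`.
[cite: CannasdasilvaGuilleminPires2010, Prop. 2.8] -/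
structure CutCollarData (M : Type u) [TopologicalSpace M] [ChartedSpace (EuclideanSpace ℝ (Fin 4)) M]
    (N : Type) [TopologicalSpace N] [ChartedSpace (EuclideanSpace ℝ (Fin 3)) N]
    [MulAction Circle N] where
  /-- The `2`-form on `M`. -/
  s : MForm (𝓡 4) M ℝ 2
  /-- The open side. -/
  V : Opens M
  /-- The `2`-form on `N` (restriction of `s` to the fold). -/
  ωZ : MForm (𝓡 3) N ℝ 2
  /-- The connection form. -/
  α : MForm (𝓡 3) N ℝ 1
  /-- The collar. -/
  c : N × ℝ → M
  /-- The width of the band. -/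
  δ : ℝ
  δ_pos : 0 < δ
  smooth_s : IsSmoothForm s
  closed_s : IsClosedForm s
  smooth_act : ContMDiff ((𝓡 1).prod (𝓡 3)) (𝓡 3) ∞ (fun x : Circle × N => x.1 • x.2)
  free_act : ∀ (a : Circle) (x : N), a • x = x → a = 1
  basic_ωZ : IsCircleBasicForm ωZ
  smooth_ωZ : IsSmoothForm ωZ
  closed_ωZ : IsClosedForm ωZ
  smooth_α : IsSmoothForm α
  inv_α : ∀ (a : Circle) (n : N) (v : Fin 1 → TangentSpace (𝓡 3) n),
    α (a • n) (fun i => mfderiv (𝓡 3) (𝓡 3) (fun y : N => a • y) n (v i)) = α n v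
  α_X : ∀ n : N, α n ![circleFundVec n] = 1
  basic_dα : IsCircleBasicForm (mextDeriv α)
  ker_ωZ : ∀ (n : N) (a : TangentSpace (𝓡 3) n), (∀ b, ωZ n ![a, b] = 0) →
    ∃ c : ℝ, a = c • circleFundVec n
  smooth_c : ContMDiffOn ((𝓡 3).prod 𝓘(ℝ, ℝ)) (𝓡 4) ∞ c (univ ×ˢ Ioo (-δ) δ)
  injOn_c : InjOn c (univ ×ˢ Ioo (-δ) δ)
  bij_c : ∀ (n : N) (t : ℝ), t ∈ Ioo (-δ) δ →
    Bijective (mfderiv ((𝓡 3).prod 𝓘(ℝ, ℝ)) (𝓡 4) c (n, t))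
  c_mem : ∀ (n : N) (t : ℝ), t ∈ Ioo 0 δ → c (n, t) ∈ V
  c_not_mem : ∀ (n : N) (t : ℝ), t ∈ Ioc (-δ) 0 → c (n, t) ∉ V
  closure_subset : closure (V : Set M) ⊆ V ∪ c '' (univ ×ˢ {0})
  pullback_c : ∀ p ∈ (univ ×ˢ Ioo (-δ) δ : Set (N × ℝ)),
    s.pullback ((𝓡 3).prod 𝓘(ℝ, ℝ)) c p =
      (ωZ.pullback ((𝓡 3).prod 𝓘(ℝ, ℝ)) (Prod.fst : N × ℝ → N) +
        mextDeriv ((fun q : N × ℝ => q.2 ^ 2) •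
          α.pullback ((𝓡 3).prod 𝓘(ℝ, ℝ)) (Prod.fst : N × ℝ → N))) p
  nondeg : ∀ x ∈ (V : Set M), ∀ v : TangentSpace (𝓡 4) x, v ≠ 0 → ∃ w, s x ![v, w] ≠ 0

namespace CutCollarData

variable {M : Type u} [TopologicalSpace M] [ChartedSpace (EuclideanSpace ℝ (Fin 4)) M]
  {N : Type} [TopologicalSpace N] [ChartedSpace (EuclideanSpace ℝ (Fin 3)) N]
  [MulAction Circle N] (D : CutCollarData M N)

/-! ### The band and the inverse collar -/

/-- The open band `N × (-δ, δ)`. [folklore] -/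
def band : Set (N × ℝ) := univ ×ˢ Ioo (-D.δ) D.δ

/-- The half band `N × (0, δ)`. [folklore] -/
def halfBand : Set (N × ℝ) := univ ×ˢ Ioo 0 D.δ

/-- The band is open. [folklore] -/
theorem isOpen_band : IsOpen D.band := isOpen_univ.prod isOpen_Ioo

/-- The half band is open. [folklore] -/
theorem isOpen_halfBand : IsOpen D.halfBand := isOpen_univ.prod isOpen_Ioo

/-- The half band lies in the band. [folklore] -/
theorem halfBand_subset_band : D.halfBand ⊆ D.band := by
  rintro ⟨n, t⟩ ⟨-, ht⟩
  exact ⟨mem_univ _, by linarith [ht.1, D.δ_pos], ht.2⟩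

/-- Membership in the band. [folklore] -/
theorem mk_mem_band {n : N} {t : ℝ} (ht : t ∈ Ioo (-D.δ) D.δ) : (n, t) ∈ D.band := ⟨mem_univ _, ht⟩

/-- Membership in the half band. [folklore] -/
theorem mk_mem_halfBand {n : N} {t : ℝ} (ht : t ∈ Ioo 0 D.δ) : (n, t) ∈ D.halfBand :=
  ⟨mem_univ _, ht⟩

/-- The image of the half band lies in `V`. [folklore] -/
theorem image_halfBand_subset : D.c '' D.halfBand ⊆ (D.V : Set M) := by
  rintro _ ⟨⟨n, t⟩, ⟨-, ht⟩, rfl⟩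
  exact D.c_mem n t ht

variable [IsManifold (𝓡 4) ∞ M] [IsManifold (𝓡 3) ∞ N]

/-- The image of the band is open. [folklore] -/
theorem isOpen_image_band : IsOpen (D.c '' D.band) :=
  isOpen_image_of_bijective_mfderiv D.isOpen_band D.smooth_c fun x hx => D.bij_c x.1 x.2 hx.2

/-- The image of the half band is open. [folklore] -/
theorem isOpen_image_halfBand : IsOpen (D.c '' D.halfBand) :=
  isOpen_image_of_bijective_mfderiv D.isOpen_halfBand (D.smooth_c.mono D.halfBand_subset_band)
    fun x hx => D.bij_c x.1 x.2 (D.halfBand_subset_band hx).2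

variable [Nonempty N]

/-- **The inverse collar** on the band image (junk elsewhere). [folklore] -/
def cInv : M → N × ℝ := invFunOn D.c D.band

omit [IsManifold (𝓡 4) ∞ M] [IsManifold (𝓡 3) ∞ N] in
/-- `cInv (c p) = p` on the band. [folklore] -/
theorem cInv_c {p : N × ℝ} (hp : p ∈ D.band) : D.cInv (D.c p) = p := invFunOn_apply D.injOn_c hp

omit [IsManifold (𝓡 4) ∞ M] [IsManifold (𝓡 3) ∞ N] in
/-- `c (cInv x) = x` on the band image. [folklore] -/
theorem c_cInv {x : M} (hx : x ∈ D.c '' D.band) : D.c (D.cInv x) = x := apply_invFunOn hx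

omit [IsManifold (𝓡 4) ∞ M] [IsManifold (𝓡 3) ∞ N] in
/-- `cInv x ∈ band` on the band image. [folklore] -/
theorem cInv_mem {x : M} (hx : x ∈ D.c '' D.band) : D.cInv x ∈ D.band :=
  Literature.Geometry.Manifold.invFunOn_mem hx

/-- **The inverse collar is `C^∞` on the band image.** [cite: LeeSmoothManifolds2013, Thm. 4.5] -/
theorem contMDiffOn_cInv : ContMDiffOn (𝓡 4) ((𝓡 3).prod 𝓘(ℝ, ℝ)) ∞ D.cInv (D.c '' D.band) :=
  contMDiffOn_invFunOn_of_bijective_mfderiv D.isOpen_band D.smooth_c D.injOn_c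
    fun x hx => D.bij_c x.1 x.2 hx.2

omit [IsManifold (𝓡 4) ∞ M] [IsManifold (𝓡 3) ∞ N] in
/-- The inverse collar is continuous on the band image. [folklore] -/
theorem continuousOn_cInv [IsManifold (𝓡 4) ∞ M] [IsManifold (𝓡 3) ∞ N] :
    ContinuousOn D.cInv (D.c '' D.band) :=
  D.contMDiffOn_cInv.continuousOn

/-! ### The two pieces -/

/-- The disc bundle `B = cutDisc δ`, the second piece of the gluing. [folklore] -/
abbrev B : Opens (CutSpace 3 N) := cutDisc D.δ

/-! ### The gluing map `V → B` -/

/-- The clamped collar height: `t` itself on `(0, δ)`, the junk value `δ/2` otherwise. [folklore] -/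
def clamp (t : ℝ) : ℝ := if t ∈ Ioo 0 D.δ then t else D.δ / 2

omit [IsManifold (𝓡 4) ∞ M] [IsManifold (𝓡 3) ∞ N] [Nonempty N] in
/-- The clamped height lies in `(0, δ)`. [folklore] -/
theorem clamp_mem (t : ℝ) : D.clamp t ∈ Ioo 0 D.δ := by
  unfold clamp
  split_ifs with h
  · exact h
  · exact ⟨half_pos D.δ_pos, half_lt_self D.δ_pos⟩

omit [IsManifold (𝓡 4) ∞ M] [IsManifold (𝓡 3) ∞ N] [Nonempty N] in
/-- On `(0, δ)` the clamp is the identity. [folklore] -/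
theorem clamp_of_mem {t : ℝ} (ht : t ∈ Ioo 0 D.δ) : D.clamp t = t := if_pos ht

omit [IsManifold (𝓡 4) ∞ M] [IsManifold (𝓡 3) ∞ N] [Nonempty N] in
/-- `[n, clamp t]` lies in the disc bundle. [folklore] -/
theorem cutSlice_clamp_mem (n : N) (t : ℝ) : cutSlice (k := 3) (n, D.clamp t) ∈ (D.B : Set (CutSpace 3 N)) := by
  show cutNormSq (cutSlice (k := 3) (n, D.clamp t)) < D.δ ^ 2
  rw [cutNormSq_cutSlice]
  have h := D.clamp_mem t
  exact pow_lt_pow_left₀ h.2 h.1.le two_ne_zero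

/-- **The gluing map** `V → cutDisc δ`: `c (n, t) ↦ [n, t]` on the half-band image.
[cite: CannasdasilvaGuilleminPires2010, Prop. 2.8] -/
def glueFun (a : D.V) : D.B :=
  ⟨cutSlice ((D.cInv a).1, D.clamp (D.cInv a).2), D.cutSlice_clamp_mem _ _⟩

/-- The source of the gluing: points of `V` in the half-band image. [folklore] -/
def glueSource : Set D.V := {a | (a : M) ∈ D.c '' D.halfBand}

/-- The target of the gluing: points of the disc bundle off the zero section. [folklore] -/
def glueTarget : Set D.B := {b | cutNormSq (b : CutSpace 3 N) ≠ 0}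

omit [IsManifold (𝓡 4) ∞ M] [IsManifold (𝓡 3) ∞ N] in
/-- The value of the gluing map at a collar point. [folklore] -/
theorem glueFun_apply {n : N} {t : ℝ} (ht : t ∈ Ioo 0 D.δ) (hV : D.c (n, t) ∈ (D.V : Set M)) :
    (D.glueFun ⟨D.c (n, t), hV⟩ : CutSpace 3 N) = cutSlice (k := 3) (n, t) := by
  show cutSlice (k := 3) ((D.cInv (D.c (n, t))).1, D.clamp (D.cInv (D.c (n, t))).2) = _
  rw [D.cInv_c (D.halfBand_subset_band (D.mk_mem_halfBand ht)), D.clamp_of_mem ht]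

omit [Nonempty N] in
/-- The source of the gluing is open. [folklore] -/
theorem isOpen_glueSource : IsOpen {a : D.V | (a : M) ∈ D.c '' D.halfBand} :=
  D.isOpen_image_halfBand.preimage continuous_subtype_val

omit [IsManifold (𝓡 4) ∞ M] [IsManifold (𝓡 3) ∞ N] [Nonempty N] in
/-- The target of the gluing is open. [folklore] -/
theorem isOpen_glueTarget : IsOpen D.glueTarget :=
  (isClosed_singleton.preimage (continuous_cutNormSq.comp continuous_subtype_val)).isOpen_compl

omit [IsManifold (𝓡 4) ∞ M] [IsManifold (𝓡 3) ∞ N] in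
/-- The gluing map takes the source into the target. [folklore] -/
theorem glueFun_mem_target {a : D.V} (ha : a ∈ D.glueSource) : D.glueFun a ∈ D.glueTarget := by
  obtain ⟨⟨n, t⟩, hnt, ha'⟩ := ha
  have hmem := D.mk_mem_halfBand (n := n) hnt.2
  have hV : D.c (n, t) ∈ (D.V : Set M) := D.image_halfBand_subset ⟨_, hmem, rfl⟩
  have haeq : a = ⟨D.c (n, t), hV⟩ := Subtype.ext ha'.symm
  subst haeq
  show cutNormSq (D.glueFun ⟨D.c (n, t), hV⟩ : CutSpace 3 N) ≠ 0
  rw [D.glueFun_apply hnt.2 hV, cutNormSq_cutSlice]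
  exact pow_ne_zero 2 hnt.2.1.ne'

/-! ### The ungluing map `B → V` -/

/-- The lift of a point of the cut space to `N × (0, δ)`: the inverse slice off the zero section,
the junk value `(n₀, δ/2)` on it. [folklore] -/
def liftB (q : CutSpace 3 N) : N × ℝ :=
  if cutNormSq q = 0 then (Classical.arbitrary N, D.δ / 2) else cutUnslice q

omit [IsManifold (𝓡 4) ∞ M] [IsManifold (𝓡 3) ∞ N] in
/-- Off the zero section the lift is the inverse slice. [folklore] -/
theorem liftB_of_ne {q : CutSpace 3 N} (hq : cutNormSq q ≠ 0) : D.liftB q = cutUnslice q := if_neg hq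

omit [IsManifold (𝓡 4) ∞ M] [IsManifold (𝓡 3) ∞ N] in
/-- The lift of a point of the disc bundle lies in the half band. [folklore] -/
theorem liftB_mem_halfBand {q : CutSpace 3 N} (hq : cutNormSq q < D.δ ^ 2) : D.liftB q ∈ D.halfBand := by
  by_cases h0 : cutNormSq q = 0
  · rw [liftB, if_pos h0]
    exact D.mk_mem_halfBand ⟨half_pos D.δ_pos, half_lt_self D.δ_pos⟩
  · rw [D.liftB_of_ne h0]
    obtain ⟨hsq, hpos⟩ := cutUnslice_snd_sq (k := 3) h0
    refine ⟨mem_univ _, hpos, ?_⟩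
    rw [← hsq] at hq
    exact lt_of_pow_lt_pow_left₀ 2 D.δ_pos.le hq

omit [IsManifold (𝓡 4) ∞ M] [IsManifold (𝓡 3) ∞ N] in
/-- The lift of a point of the disc bundle lies in the band. [folklore] -/
theorem liftB_mem_band {q : CutSpace 3 N} (hq : cutNormSq q < D.δ ^ 2) : D.liftB q ∈ D.band :=
  D.halfBand_subset_band (D.liftB_mem_halfBand hq)

/-- **The ungluing map** `cutDisc δ → V`: `[n, w] ↦ c (cutUnslice [n, w])` off the zero section.
[cite: CannasdasilvaGuilleminPires2010, Prop. 2.8] -/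
def unglueFun (b : D.B) : D.V :=
  ⟨D.c (D.liftB b), D.image_halfBand_subset ⟨_, D.liftB_mem_halfBand b.2, rfl⟩⟩

omit [IsManifold (𝓡 4) ∞ M] [IsManifold (𝓡 3) ∞ N] in
/-- The value of the ungluing map. [folklore] -/
@[simp] theorem coe_unglueFun (b : D.B) : (D.unglueFun b : M) = D.c (D.liftB b) := rfl

omit [IsManifold (𝓡 4) ∞ M] [IsManifold (𝓡 3) ∞ N] in
/-- The ungluing map takes the target into the source. [folklore] -/
theorem unglueFun_mem_source (b : D.B) : D.unglueFun b ∈ D.glueSource :=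
  ⟨_, D.liftB_mem_halfBand b.2, rfl⟩

omit [IsManifold (𝓡 4) ∞ M] [IsManifold (𝓡 3) ∞ N] in
/-- **`unglue ∘ glue = id` on the source.** [folklore] -/
theorem unglueFun_glueFun {a : D.V} (ha : a ∈ D.glueSource) : D.unglueFun (D.glueFun a) = a := by
  obtain ⟨⟨n, t⟩, hnt, ha'⟩ := ha
  have hmem := D.mk_mem_halfBand (n := n) hnt.2
  have hV : D.c (n, t) ∈ (D.V : Set M) := D.image_halfBand_subset ⟨_, hmem, rfl⟩
  have haeq : a = ⟨D.c (n, t), hV⟩ := Subtype.ext ha'.symm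
  subst haeq
  apply Subtype.ext
  show D.c (D.liftB (D.glueFun ⟨D.c (n, t), hV⟩ : CutSpace 3 N)) = D.c (n, t)
  rw [D.glueFun_apply hnt.2 hV, D.liftB_of_ne (by rw [cutNormSq_cutSlice]; exact pow_ne_zero 2 hnt.2.1.ne'),
    cutUnslice_cutSlice n hnt.2.1]

omit [IsManifold (𝓡 4) ∞ M] [IsManifold (𝓡 3) ∞ N] in
/-- **`glue ∘ unglue = id` on the target.** [folklore] -/
theorem glueFun_unglueFun {b : D.B} (hb : b ∈ D.glueTarget) : D.glueFun (D.unglueFun b) = b := by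
  have hb0 : cutNormSq (b : CutSpace 3 N) ≠ 0 := hb
  obtain ⟨hsq, hpos⟩ := cutUnslice_snd_sq (k := 3) hb0
  have hlt : (cutUnslice (b : CutSpace 3 N)).2 < D.δ := by
    have h := b.2
    change cutNormSq (b : CutSpace 3 N) < D.δ ^ 2 at h
    rw [← hsq] at h
    exact lt_of_pow_lt_pow_left₀ 2 D.δ_pos.le h
  apply Subtype.ext
  show cutSlice (k := 3) ((D.cInv (D.c (D.liftB b))).1, D.clamp (D.cInv (D.c (D.liftB b))).2) = b
  rw [D.cInv_c (D.liftB_mem_band b.2), D.liftB_of_ne hb0, D.clamp_of_mem ⟨hpos, hlt⟩, Prod.mk.eta,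
    cutSlice_cutUnslice hb0]

/-! ### Smoothness of the two maps -/

section Smooth

variable [T2Space N]

/-- The charted-space structure of the cut space (slice charts). [folklore] -/
@[reducible] def csB : ChartedSpace (EuclideanSpace ℝ (Fin (3 + 1))) (CutSpace 3 N) :=
  cutChartedSpace D.smooth_act D.free_act

/-- A corestriction `g : X → U'` of `f` to an open submanifold has at `x` every manifold
derivative that `f` has (private copy of the tree's
`Literature.Topology.FourManifolds.hasMFDerivAt_codRestrict_opens`, to keep imports small). [folklore] -/
private theorem contMDiffOn_codRestrict_opens {EX HX : Type*} [NormedAddCommGroup EX] [NormedSpace ℝ EX]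
    [TopologicalSpace HX] {IX : ModelWithCorners ℝ EX HX} {X : Type*} [TopologicalSpace X]
    [ChartedSpace HX X] {EY HY : Type*} [NormedAddCommGroup EY] [NormedSpace ℝ EY]
    [TopologicalSpace HY] {IY : ModelWithCorners ℝ EY HY} {Y : Type*} [TopologicalSpace Y]
    [ChartedSpace HY Y] {U' : Opens Y} {f : X → Y} {g : X → U'} (hfg : ∀ y, (g y : Y) = f y)
    {S : Set X} (hf : ContMDiffOn IX IY ∞ f S) : ContMDiffOn IX IY ∞ g S := by
  intro x hx
  have h : ContMDiffWithinAt IX IY ∞ (Subtype.val ∘ g) S x := by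
    have : (Subtype.val ∘ g) = f := funext hfg
    rw [this]
    exact hf x hx
  exact (ContMDiffWithinAt.subtypeVal_comp_iff U' g S x).1 h

/-- **The gluing map is `C^∞` on its source** (`cutSlice ∘ cInv` there). [folklore] -/
theorem contMDiffOn_glueFun :
    letI := D.csB
    ContMDiffOn (𝓡 4) (𝓡 (3 + 1)) ∞ D.glueFun D.glueSource := by
  letI := D.csB
  haveI := isManifold_cutSpace D.smooth_act D.free_act
  -- the underlying map into the cut space
  have hval : ContMDiffOn (𝓡 4) (𝓡 (3 + 1)) ∞
      (fun a : D.V => (cutSlice (k := 3) (D.cInv (a : M)) : CutSpace 3 N)) D.glueSource := by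
    have h1 : ContMDiffOn (𝓡 4) ((𝓡 3).prod 𝓘(ℝ, ℝ)) ∞ (fun a : D.V => D.cInv (a : M)) D.glueSource := by
      refine D.contMDiffOn_cInv.comp contMDiff_subtype_val.contMDiffOn ?_
      intro a ha
      exact image_mono D.halfBand_subset_band ha
    exact (contMDiff_cutSlice D.smooth_act D.free_act).comp_contMDiffOn h1
  have hval' : ContMDiffOn (𝓡 4) (𝓡 (3 + 1)) ∞
      (fun a : D.V => (D.glueFun a : CutSpace 3 N)) D.glueSource := by
    refine hval.congr ?_
    intro a ha
    obtain ⟨⟨n, t⟩, hnt, ha'⟩ := ha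
    have hmem := D.mk_mem_halfBand (n := n) hnt.2
    show cutSlice (k := 3) ((D.cInv a).1, D.clamp (D.cInv a).2) = cutSlice (k := 3) (D.cInv a)
    rw [← ha', D.cInv_c (D.halfBand_subset_band hmem), D.clamp_of_mem hnt.2]
  exact contMDiffOn_codRestrict_opens (fun a => rfl) hval'

omit [IsManifold (𝓡 4) ∞ M] in
/-- The lift `liftB` is `C^∞` off the zero section. [folklore] -/
theorem contMDiffOn_liftB :
    letI := D.csB
    ContMDiffOn (𝓡 (3 + 1)) ((𝓡 3).prod 𝓘(ℝ, ℝ)) ∞ D.liftB {q : CutSpace 3 N | cutNormSq q ≠ 0} := by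
  letI := D.csB
  exact (contMDiffOn_cutUnslice D.smooth_act D.free_act).congr fun q hq => D.liftB_of_ne hq

omit [IsManifold (𝓡 4) ∞ M] in
/-- **The ungluing map is `C^∞` on its target** (`c ∘ cutUnslice` there). [folklore] -/
theorem contMDiffOn_unglueFun :
    letI := D.csB
    ContMDiffOn (𝓡 (3 + 1)) (𝓡 4) ∞ D.unglueFun D.glueTarget := by
  letI := D.csB
  haveI := isManifold_cutSpace D.smooth_act D.free_act
  have h1 : ContMDiffOn (𝓡 (3 + 1)) ((𝓡 3).prod 𝓘(ℝ, ℝ)) ∞ (fun b : D.B => D.liftB (b : CutSpace 3 N))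
      D.glueTarget :=
    D.contMDiffOn_liftB.comp contMDiff_subtype_val.contMDiffOn fun b hb => hb
  have h2 : ContMDiffOn (𝓡 (3 + 1)) (𝓡 4) ∞ (fun b : D.B => D.c (D.liftB (b : CutSpace 3 N)))
      D.glueTarget :=
    D.smooth_c.comp h1 fun b _ => D.liftB_mem_band b.2
  exact contMDiffOn_codRestrict_opens (fun b => rfl) h2

/-- The gluing map is continuous on its source. [folklore] -/
theorem continuousOn_glueFun : ContinuousOn D.glueFun {a : D.V | (a : M) ∈ D.c '' D.halfBand} := by
  letI := D.csB
  exact D.contMDiffOn_glueFun.continuousOn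

omit [IsManifold (𝓡 4) ∞ M] in
/-- The ungluing map is continuous on its target. [folklore] -/
theorem continuousOn_unglueFun : ContinuousOn D.unglueFun D.glueTarget := by
  letI := D.csB
  exact D.contMDiffOn_unglueFun.continuousOn

end Smooth

end CutCollarData

end Literature.Geometry.Symplectic

end
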